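import Summits.Ventures.PercRepro.C041TriDomTwoCutMain

/-!
# ROW C-041 — THEOREM (2-CUT GLUING) FOR THE SIBLING DOMINATION
(p6, gen 46; P6-TWOEXIT-LEAN.md §53 ADDENDUM 18)

The sibling domination (marks `x, y`, terminal `t`, all off the far side) across a pair `{u, v}` with a markless far
side and an absent chord `c₀ = u–v`: from the sibling on `stOut2S`, `stDbl` and `stChord` (`sibDominationS_of_twoCut`).
The sibling classes and target are cut-related exactly like the crossed classes (`sibSrc_cutRel`, `sibTop_cutRel`):
they are built from the six connectivities among `x, y, t`, each of which THE THROUGH-LEMMA realises on the chord.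
With `C041TriDomTwoCutMain` the family `{conjecture, sibling}` is closed under the 2-cut gluing, as it is under the
cut-vertex gluing (ADDENDUM 16) and the two-exit piece (ADDENDUM 17).
-/

namespace PercRepro

namespace ZoneZ

namespace MultiExit

open ZoneData Finset Classical

variable {V₁ E₁ U₁ U₂ : Type} (Z₁ : ZoneData V₁ E₁ U₁ U₂) [Fintype E₁] [DecidableEq E₁]
variable {st : E₁ → EStat} {u v w : V₁} {c₀ : E₁}

/-- The sibling classes of `st` are cut-related to those of the three chord statuses. -/
theorem sibSrc_cutRel (hwu : w ≠ u) (hwv : w ≠ v) (hc₀ : st c₀ = EStat.absent) (hc : Z₁.Joins c₀ u v)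
    (x y t : V₁) (hx : x ∉ side2 Z₁ st u v w) (hy : y ∉ side2 Z₁ st u v w) (ht : t ∉ side2 Z₁ st u v w) :
    CutRel (InC2S Z₁ st u v w) c₀ (fun i => RdS Z₁ (stIn2S Z₁ st u v w) i u v)
      (fun i => MgS Z₁ (stIn2S Z₁ st u v w) i u v) (fun ω => SibC₁ Z₁ x y t st ω ∨ SibC₃ Z₁ x y t st ω)
      (fun ω => SibC₁ Z₁ x y t (stOut2S Z₁ st u v w) ω ∨ SibC₃ Z₁ x y t (stOut2S Z₁ st u v w) ω)
      (fun ω => SibC₁ Z₁ x y t (stDbl Z₁ st u v w c₀) ω ∨ SibC₃ Z₁ x y t (stDbl Z₁ st u v w c₀) ω)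
      (fun ω => SibC₁ Z₁ x y t (stChord Z₁ st u v w c₀) ω ∨ SibC₃ Z₁ x y t (stChord Z₁ st u v w c₀) ω) where
  hN o i _ _ hr hb := by
    unfold SibC₁ SibC₃
    rw [(conn_N Z₁ hwu hwv o i hr hb hx hy).1, (conn_N Z₁ hwu hwv o i hr hb hx ht).1,
      (conn_N Z₁ hwu hwv o i hr hb hy ht).1, (conn_N Z₁ hwu hwv o i hr hb hx hy).2,
      (conn_N Z₁ hwu hwv o i hr hb hx ht).2, (conn_N Z₁ hwu hwv o i hr hb hy ht).2]
  hD o i _ _ hr hb := by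
    unfold SibC₁ SibC₃
    rw [(conn_D Z₁ hwu hwv hc₀ hc o i hr hb hx hy).1, (conn_D Z₁ hwu hwv hc₀ hc o i hr hb hx ht).1,
      (conn_D Z₁ hwu hwv hc₀ hc o i hr hb hy ht).1, (conn_D Z₁ hwu hwv hc₀ hc o i hr hb hx hy).2,
      (conn_D Z₁ hwu hwv hc₀ hc o i hr hb hx ht).2, (conn_D Z₁ hwu hwv hc₀ hc o i hr hb hy ht).2]
  hC o i _ _ hrb := by
    unfold SibC₁ SibC₃
    rw [(conn_C Z₁ hwu hwv hc₀ hc o i hrb hx hy).1, (conn_C Z₁ hwu hwv hc₀ hc o i hrb hx ht).1,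
      (conn_C Z₁ hwu hwv hc₀ hc o i hrb hy ht).1, (conn_C Z₁ hwu hwv hc₀ hc o i hrb hx hy).2,
      (conn_C Z₁ hwu hwv hc₀ hc o i hrb hx ht).2, (conn_C Z₁ hwu hwv hc₀ hc o i hrb hy ht).2]
  hout ω := by
    unfold SibC₁ SibC₃
    refine ⟨?_, ?_, ?_⟩
    · rw [RdS_stOut2S_congr_out Z₁ (outN_agree_out Z₁ ω), MgS_stOut2S_congr_out Z₁ (outN_agree_out Z₁ ω)]
    · rw [RdS_stDbl_congr_out Z₁ (outN_agree_out Z₁ ω), MgS_stDbl_congr_out Z₁ (outN_agree_out Z₁ ω)]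
    · rw [RdS_stChord_congr_out Z₁ hwu hwv hc (outN_agree_out Z₁ ω),
        MgS_stChord_congr_out Z₁ hwu hwv hc (outN_agree_out Z₁ ω)]

/-- The sibling target of `st` is cut-related to those of the three chord statuses. -/
theorem sibTop_cutRel (hwu : w ≠ u) (hwv : w ≠ v) (hc₀ : st c₀ = EStat.absent) (hc : Z₁.Joins c₀ u v)
    (x y t : V₁) (hx : x ∉ side2 Z₁ st u v w) (hy : y ∉ side2 Z₁ st u v w) (ht : t ∉ side2 Z₁ st u v w) :
    CutRel (InC2S Z₁ st u v w) c₀ (fun i => RdS Z₁ (stIn2S Z₁ st u v w) i u v)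
      (fun i => MgS Z₁ (stIn2S Z₁ st u v w) i u v) (SibTop Z₁ x y t st)
      (SibTop Z₁ x y t (stOut2S Z₁ st u v w)) (SibTop Z₁ x y t (stDbl Z₁ st u v w c₀))
      (SibTop Z₁ x y t (stChord Z₁ st u v w c₀)) where
  hN o i _ _ hr hb := by
    unfold SibTop
    rw [(conn_N Z₁ hwu hwv o i hr hb hx hy).1, (conn_N Z₁ hwu hwv o i hr hb hx ht).1,
      (conn_N Z₁ hwu hwv o i hr hb hy ht).1, (conn_N Z₁ hwu hwv o i hr hb hx hy).2]
  hD o i _ _ hr hb := by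
    unfold SibTop
    rw [(conn_D Z₁ hwu hwv hc₀ hc o i hr hb hx hy).1, (conn_D Z₁ hwu hwv hc₀ hc o i hr hb hx ht).1,
      (conn_D Z₁ hwu hwv hc₀ hc o i hr hb hy ht).1, (conn_D Z₁ hwu hwv hc₀ hc o i hr hb hx hy).2]
  hC o i _ _ hrb := by
    unfold SibTop
    rw [(conn_C Z₁ hwu hwv hc₀ hc o i hrb hx hy).1, (conn_C Z₁ hwu hwv hc₀ hc o i hrb hx ht).1,
      (conn_C Z₁ hwu hwv hc₀ hc o i hrb hy ht).1, (conn_C Z₁ hwu hwv hc₀ hc o i hrb hx hy).2]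
  hout ω := by
    unfold SibTop
    refine ⟨?_, ?_, ?_⟩
    · rw [RdS_stOut2S_congr_out Z₁ (outN_agree_out Z₁ ω), MgS_stOut2S_congr_out Z₁ (outN_agree_out Z₁ ω)]
    · rw [RdS_stDbl_congr_out Z₁ (outN_agree_out Z₁ ω), MgS_stDbl_congr_out Z₁ (outN_agree_out Z₁ ω)]
    · rw [RdS_stChord_congr_out Z₁ hwu hwv hc (outN_agree_out Z₁ ω),
        MgS_stChord_congr_out Z₁ hwu hwv hc (outN_agree_out Z₁ ω)]

/-- **THEOREM (2-CUT GLUING)** for the sibling domination. -/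
theorem sibDominationS_of_twoCut (hwu : w ≠ u) (hwv : w ≠ v) (hc₀ : st c₀ = EStat.absent) (hc : Z₁.Joins c₀ u v)
    (x y t : V₁) (hx : x ∉ side2 Z₁ st u v w) (hy : y ∉ side2 Z₁ st u v w) (ht : t ∉ side2 Z₁ st u v w)
    (hN : SibDominationS Z₁ x y t (stOut2S Z₁ st u v w)) (hD : SibDominationS Z₁ x y t (stDbl Z₁ st u v w c₀))
    (hC : SibDominationS Z₁ x y t (stChord Z₁ st u v w c₀)) : SibDominationS Z₁ x y t st := by
  intro V hV
  obtain ⟨ψ, hinj, hψ⟩ := exists_transport2 Z₁ (st := st) (u := u) (v := v) (w := w)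
  have key := dom_of_twoCut_count (not_InC2S_chord Z₁ hwu hwv hc)
    (sibSrc_cutRel Z₁ hwu hwv hc₀ hc x y t hx hy ht) (sibTop_cutRel Z₁ hwu hwv hc₀ hc x y t hx hy ht)
    (fun V hV => (card_filter_inst.trans_le (hN V hV)).trans_eq card_filter_inst)
    (fun V hV => (card_filter_inst.trans_le (hD V hV)).trans_eq card_filter_inst)
    (fun V hV => (card_filter_inst.trans_le (hC V hV)).trans_eq card_filter_inst) ψ hψ hinj V hV
  exact (card_filter_inst.trans_le key).trans_eq card_filter_inst

end MultiExit

end ZoneZ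

end PercRepro
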